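import Summits.PneNP.PneNP.Theorems.ChebyshevTracialDesignTransversalSquareSum
import Literature.Combinatorics.AssociationSchemes.JohnsonSpectrum
import HarnessLib

/-!
# Cell pnp-psdrank, route `ChebyshevTracialDesign`: the square sum of the matching-side functional of the dipole
# product `χ = Π_i (x_{a_i} − x_{b_i})` — brick (R1) of the σ₂ step, closed form

Harmonic backbone of the `r = 1` rung of the crux `TracialDecayExp20` (stmt-PneNP-19878). Combining the signed square
sum over closed transversals (`…TransversalSquareSum.sum_sq_transversalFunctional`, this seat) with the literature
seat's coefficient lemmas for the dipole product (`Literature.Combinatorics.AssociationSchemes.JohnsonSpectrum`: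
`dipoleVec_apply_transversal`, `dipoleVec_apply_eq_zero_of_mem`, `dipoleVec_apply_eq_zero_of_pair_mem`,
`eq_image_sel_of_subset_of_card`, `isHomog_dipoleVec` [cite: Filmus2016, Def. 2.2 / Lemma 2.3 (arXiv pp. 4–5)]):
for `k` dipoles `a, b : Fin k → Fin n` (injective, disjoint ranges) and `χ = dipoleVec k a b`,
* `dipoleVec_apply_section` : `χ(T_S) = (−1)^k · (−1)^{|S|}` on the transversal of a section `S ⊆ Fin k`;
* `dipoleVec_apply_eq_zero_of_not_transversal` : `χ(T) = 0` off the transversals;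
* `sum_sq_dipoleFunctional` : with `Π_χ(M) = Σ_{T : #{x ∈ T : partner x ∈ T} = k} χ_T` (prover g5's matching-side
  functional, `…TightColumnSums`),
  `Σ_{M : PMatch n} Π_χ(M)² = 2^k · Σ_{d ≤ k, d even} C(k,d) · pm(k−d) · pm(d)² · pm(n−k−d)`
  (`pm = pmCount`, `pm(2m) = (2m−1)‼`); e.g. `k = 2`, `n = 10`: `4·(105 + 15) = 480`.
With the prover's `kernelEigen_tight_even_mul` this is the closed form (★★) of the even eigenvalues of the tight
Gram kernel (MEMO-7 ADDENDUM §B (R1)); background [cite: GodsilMeagher2015, §15.2].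
WHAT THIS IS NOT: not the eigenvalue assembly nor the monotonicity in `κ`; nothing on psd rank. Supports crux
stmt-PneNP-19878.
-/

set_option linter.dupNamespace false -- `Summit.PneNP.PneNP.…`: summit = sub-problem (D-0017)

namespace Summit.PneNP.PneNP.Theorems.ChebyshevTracialDesignDipoleSquareSum

open Finset Literature.Barriers.PneNP Literature.Combinatorics.AssociationSchemes
open Literature.Combinatorics.AssociationSchemes.JohnsonHarmonics
open Literature.Combinatorics.AssociationSchemes.JohnsonSpectrum
open Summit.PneNP.PneNP.Theorems.ChebyshevTracialDesignClosedPairCount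
open Summit.PneNP.PneNP.Theorems.ChebyshevTracialDesignTransversalSquareSum

variable {n k : ℕ} {a b : Fin k → Fin n}

/-- **The dipole product on the transversal of a section**: `χ(T_S) = (−1)^k · (−1)^{|S|}` (the literature seat's
`(−1)^{#b-choices}` with `#b-choices = k − |S|`). [cite: Filmus2016, Def. 2.2 (arXiv p. 4)] -/
theorem dipoleVec_apply_section (ha : Function.Injective a) (hb : Function.Injective b) (hab : ∀ i j, a i ≠ b j)
    (S : Finset (Fin k)) :
    dipoleVec k a b (univ.image fun i => if i ∈ S then a i else b i) = (-1 : ℝ) ^ k * (-1) ^ S.card := by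
  classical
  have h := dipoleVec_apply_transversal k a b ha hb hab (fun i => decide (i ∈ S))
  have himg : (univ.image fun i => if decide (i ∈ S) = true then a i else b i) =
      univ.image fun i => if i ∈ S then a i else b i := by
    congr 1
    funext i
    simp only [decide_eq_true_eq]
  have hfilt : (univ.filter fun i : Fin k => decide (i ∈ S) = false) = Sᶜ := by
    ext i
    simp only [mem_filter, mem_univ, true_and, mem_compl, decide_eq_false_iff_not]
  simp only [himg, hfilt] at h
  rw [h, card_compl, Fintype.card_fin]
  have hle : S.card ≤ k := by simpa using S.card_le_univ
  have key : (-1 : ℝ) ^ (k - S.card) * (-1) ^ S.card = (-1) ^ k := by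
    rw [← pow_add, Nat.sub_add_cancel hle]
  rw [← key, mul_assoc, ← pow_add, ← two_mul, pow_mul]
  norm_num

/-- **The dipole product vanishes off the transversals.** [cite: Filmus2016, Def. 2.2 / Lemma 2.3 (arXiv pp. 4–5)] -/
theorem dipoleVec_apply_eq_zero_of_not_transversal (ha : Function.Injective a) (hb : Function.Injective b)
    (hab : ∀ i j, a i ≠ b j) {T : Finset (Fin n)}
    (hT : ∀ S : Finset (Fin k), T ≠ univ.image fun i => if i ∈ S then a i else b i) :
    dipoleVec k a b T = 0 := by
  classical
  -- a point outside the dipoles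
  by_cases h1 : ∃ c ∈ T, (∀ i, a i ≠ c) ∧ ∀ i, b i ≠ c
  · obtain ⟨c, hc, hca, hcb⟩ := h1
    exact dipoleVec_apply_eq_zero_of_mem a b hc hca hcb
  -- a full dipole
  by_cases h2 : ∃ i, a i ∈ T ∧ b i ∈ T
  · obtain ⟨i, hai, hbi⟩ := h2
    exact dipoleVec_apply_eq_zero_of_pair_mem k a b ha hb hab i hai hbi
  -- wrong size
  by_cases h3 : T.card = k
  swap
  · exact isHomog_dipoleVec k a b T h3
  -- otherwise `T` is a transversal (pigeonhole), contradiction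
  exfalso
  push Not at h1 h2
  have hsub : T ⊆ (univ : Finset (Fin k)).image a ∪ (univ : Finset (Fin k)).image b := by
    intro c hc
    rw [mem_union, mem_image, mem_image]
    by_cases hca : ∀ i, a i ≠ c
    · obtain ⟨i, hi⟩ := h1 c hc hca
      exact Or.inr ⟨i, mem_univ _, hi⟩
    · push Not at hca
      obtain ⟨i, hi⟩ := hca
      exact Or.inl ⟨i, mem_univ _, hi⟩
  have heq := eq_image_sel_of_subset_of_card ha hb hab hsub h3 fun i hi => h2 i hi.1 hi.2
  apply hT (univ.filter fun i => a i ∈ T)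
  refine heq.trans ?_
  congr 1
  funext i
  simp only [mem_filter, mem_univ, true_and]

/-- **Square sum of the matching-side functional of the dipole product.** For `k` dipoles `a, b : Fin k → Fin n`
(injective, disjoint ranges) and `χ = dipoleVec k a b`:
`Σ_{M} (Σ_{T : #{x ∈ T : partner x ∈ T} = k} χ_T)² = 2^k · Σ_{d ≤ k, d even} C(k,d) · pm(k−d) · pm(d)² · pm(n−k−d)`.
[cite: GodsilMeagher2015, §15.2] -/
theorem sum_sq_dipoleFunctional (ha : Function.Injective a) (hb : Function.Injective b) (hab : ∀ i j, a i ≠ b j) :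
    ∑ M : PMatch n,
        (∑ T ∈ univ.filter (fun T : Finset (Fin n) => (T.filter fun x => M.2.partner x ∈ T).card = k),
          dipoleVec k a b T) ^ 2 =
      2 ^ k * ∑ d ∈ range (k + 1),
        if Even d then (k.choose d : ℝ) * pmCount (k - d) * pmCount d ^ 2 * pmCount (n - k - d) else 0 := by
  rw [sum_sq_transversalFunctional ha hb hab (dipoleVec k a b) ((-1) ^ k) (dipoleVec_apply_section ha hb hab)
    (fun T hT => dipoleVec_apply_eq_zero_of_not_transversal ha hb hab hT)]
  have : ((-1 : ℝ) ^ k) ^ 2 = 1 := by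
    rw [← pow_mul, mul_comm, pow_mul]
    norm_num
  rw [this, one_mul]

end Summit.PneNP.PneNP.Theorems.ChebyshevTracialDesignDipoleSquareSum
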